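import Summits.SmoothPoincare4.SmoothPoincare4.Theses.InformationMetricHadamard
import Summits.SmoothPoincare4.SmoothPoincare4.Theorems.InformationMetricHadamardC0AhRecognitionStubFarCollarPackage
import Summits.SmoothPoincare4.SmoothPoincare4.Theorems.InformationMetricHadamardC0AhRecognitionStubFarCollarImmersive
import Summits.SmoothPoincare4.SmoothPoincare4.Theorems.InformationMetricHadamardC0AhRecognitionStubFarCollarIsFar
import Summits.SmoothPoincare4.SmoothPoincare4.Theorems.InformationMetricHadamardAhHadamardFillingStubCollarPackage
import Literature.Geometry.Riemannian.RiemannianDistance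
import Mathlib.Topology.Homotopy.Product
import Mathlib.Analysis.Convex.Contractible

/-!
# Stub `stub_collarSheetData` of line `universal-cover-strips-topology`
(crux `InformationMetricHadamard.AhHadamardFilling`, item stmt-SmoothPoincare4-6014; stub S3 of the
lead's skeleton)

**The collar supplies the sheet data.** For the crux's end collar `Φ : Σ × (0,1) → W⁵` of a
homotopy 4-sphere `Σ` (smooth, injective, closure clause, `C⁰` cone asymptotics with `c > 0` over a
Riemannian `g`) in ANY Riemannian 5-manifold `W` — no connectivity, completeness or curvature
hypothesis — there are

* a simply connected, locally path connected space `T = Σ × (0,t₀)` with an open topological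
  embedding `ι = Φ| : T → W`, where `t₀` is the immersive depth of the landed
  `C0AhRecognition.Sketch.stub_farCollarImmersive` (openness: inverse function theorem `4 + 1 = 5`,
  landed as `CoreDistanceMorse.FarCollarPackage.isOpen_image_collar_far`; `Σ` is simply connected,
  landed as `AhHadamardFilling.Sketch.simplyConnectedSpace_carrier`, and `(0,t₀)` is convex);
* the open far part `U = Φ(Σ × (0,t))`, `t = t₀/2`, with `closure U = Φ(Σ × (0,t]) ⊆ range ι`
  (landed `FarCollarPackage.closure_image_far'`), compact frontier `⊆ Φ(Σ × {t})`, and NON-compact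
  closure: the deep points `Φ(y₀,l)`, `l → 0⁺`, lie in `U` and are at unbounded distance from any
  point (landed `C0AhRecognition.Sketch.stub_farCollarIsFar`), so they have no cluster point.

Everything is proved (kind = proof); no definitions.
-/

noncomputable section

-- the prescribed namespace `Summit.<P>.<Sub>.…` duplicates `SmoothPoincare4` (P = Sub)
set_option linter.dupNamespace false

open scoped Manifold ContDiff Topology ENNReal NNReal
open Set Function

namespace Summit.SmoothPoincare4.SmoothPoincare4.Cruxes.AhHadamardFilling.UniversalCoverStripsTopology

open Literature.Topology.FourManifolds (HomotopySphere)
open Literature.Geometry.Lorentzian (PseudoRiemannianMetric)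
open Summit.SmoothPoincare4.SmoothPoincare4.Cruxes.C0AhRecognition.CoreDistanceMorse
  (FarCollarPackage.isOpen_image_collar_far FarCollarPackage.isOpen_image_far'
    FarCollarPackage.closure_image_far')

/-! ## Simple connectivity of the strip `Σ × (0,t₀)` -/

-- adapted from Literature/Topology/FourManifolds/SphereCapComplement.lean (`simplyConnectedSpace_prod`)
/-- **A product of simply connected spaces is simply connected**: a path class in `α × β` is the
product of its two projections (Mathlib `Path.Homotopic.prod_projLeft_projRight`), which are
unique. [folklore] -/
private theorem simplyConnectedSpace_prod {α β : Type*} [TopologicalSpace α] [TopologicalSpace β]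
    [SimplyConnectedSpace α] [SimplyConnectedSpace β] : SimplyConnectedSpace (α × β) := by
  rw [simply_connected_iff_paths_homotopic]
  refine ⟨inferInstance, ?_⟩
  rintro ⟨a₁, b₁⟩ ⟨a₂, b₂⟩
  refine ⟨fun p q => ?_⟩
  rw [← Path.Homotopic.prod_projLeft_projRight p, ← Path.Homotopic.prod_projLeft_projRight q,
    Subsingleton.elim (Path.Homotopic.projLeft p) (Path.Homotopic.projLeft q),
    Subsingleton.elim (Path.Homotopic.projRight p) (Path.Homotopic.projRight q)]

/-- **The strip `X × (0,t₀)` over a simply connected `X` is simply connected** (`t₀ > 0`): the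
interval `(0,t₀)` is convex and nonempty, hence contractible, hence simply connected. [folklore] -/
private theorem simplyConnectedSpace_strip (X : Type*) [TopologicalSpace X] [SimplyConnectedSpace X]
    {t₀ : ℝ} (ht₀ : 0 < t₀) : SimplyConnectedSpace (X × Ioo (0 : ℝ) t₀) := by
  haveI : ContractibleSpace (Ioo (0 : ℝ) t₀) :=
    (convex_Ioo (0 : ℝ) t₀).contractibleSpace (nonempty_Ioo.2 ht₀)
  exact simplyConnectedSpace_prod

/-! ## The collar restricted to the immersive strip is an open embedding -/

/-- **`Ψ| : N × (0,t₀) → W` is an open topological embedding** if `Ψ` is smooth and injective on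
`N × (0,1)` and immersive on `N × (0,t₀)`, `t₀ ≤ 1`: it is continuous and injective there, and open
by the inverse function theorem (`4 + 1 = 5`, landed `FarCollarPackage.isOpen_image_collar_far`),
the inclusion `N × (0,t₀) ↪ N × ℝ` being itself an open embedding. [folklore] -/
private theorem isOpenEmbedding_strip
    {N : Type} [TopologicalSpace N] [ChartedSpace (EuclideanSpace ℝ (Fin 4)) N]
    [IsManifold (𝓡 4) ∞ N]
    {W : Type} [TopologicalSpace W] [ChartedSpace (EuclideanSpace ℝ (Fin 5)) W]
    [IsManifold (𝓡 5) ∞ W] (Ψ : N × ℝ → W)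
    (hsm : ContMDiffOn ((𝓡 4).prod 𝓘(ℝ, ℝ)) (𝓡 5) ∞ Ψ (univ ×ˢ Ioo (0 : ℝ) 1))
    (hinj : InjOn Ψ (univ ×ˢ Ioo (0 : ℝ) 1))
    {t₀ : ℝ} (ht₀ : t₀ ≤ 1)
    (himm : ∀ (y : N) (l : ℝ), l ∈ Ioo (0 : ℝ) t₀ →
      Injective (mfderiv ((𝓡 4).prod 𝓘(ℝ, ℝ)) (𝓡 5) Ψ (y, l))) :
    Topology.IsOpenEmbedding
      (Ψ ∘ (Prod.map id Subtype.val : N × Ioo (0 : ℝ) t₀ → N × ℝ)) := by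
  -- the inclusion of the strip is an open embedding into `N × ℝ`
  have hemb : Topology.IsOpenEmbedding (Prod.map id Subtype.val : N × Ioo (0 : ℝ) t₀ → N × ℝ) :=
    Topology.IsOpenEmbedding.id.prodMap isOpen_Ioo.isOpenEmbedding_subtypeVal
  have hmem : ∀ p : N × Ioo (0 : ℝ) t₀,
      Prod.map id Subtype.val p ∈ (univ ×ˢ Ioo (0 : ℝ) 1 : Set (N × ℝ)) :=
    fun p ↦ ⟨mem_univ _, p.2.2.1, p.2.2.2.trans_le ht₀⟩
  refine Topology.IsOpenEmbedding.of_continuous_injective_isOpenMap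
    (hsm.continuousOn.comp_continuous hemb.continuous hmem)
    (fun p q h ↦ hemb.injective (hinj (hmem p) (hmem q) h)) ?_
  intro O hO
  rw [image_comp]
  refine FarCollarPackage.isOpen_image_collar_far Ψ hsm ht₀ himm (hemb.isOpenMap O hO) ?_
  rintro _ ⟨p, -, rfl⟩
  exact ⟨mem_univ _, p.2.2⟩

/-- The range of the restricted collar is the far part `Ψ(N × (0,t₀))`. [folklore] -/
private theorem range_strip {N : Type} {W : Type} (Ψ : N × ℝ → W) (t₀ : ℝ) :
    range (Ψ ∘ (Prod.map id Subtype.val : N × Ioo (0 : ℝ) t₀ → N × ℝ)) =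
      Ψ '' (univ ×ˢ Ioo (0 : ℝ) t₀) := by
  rw [range_comp, range_prodMap, range_id, Subtype.range_coe]

/-! ## The closure of a far part is not compact -/

/-- **Far parts have non-compact closure.** If deep points are metrically far from every base
point (`hfar`, the conclusion of the landed `Sketch.stub_farCollarIsFar`) and `N ≠ ∅`, then
`cl Ψ(N × (0,t))`, `t > 0`, is not compact: otherwise the points `Ψ(y₀, l)`, `l → 0⁺`, of the far
part would have a cluster point `p`, whose distance-`1` ball would contain points `Ψ(y₀, l)` with
`l` arbitrarily small, at distance `> 1` from `p`. [folklore] -/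
private theorem not_isCompact_closure_far
    {N : Type} [Nonempty N]
    {W : Type} [TopologicalSpace W] [ChartedSpace (EuclideanSpace ℝ (Fin 5)) W]
    [IsManifold (𝓡 5) ∞ W] [RegularSpace W] (Ψ : N × ℝ → W)
    (G : PseudoRiemannianMetric (𝓡 5) ∞ (EuclideanSpace ℝ (Fin 5)) (TangentSpace (𝓡 5) : W → Type _))
    (hG : G.IsRiemannian)
    (hfar : ∀ (x₀ : W) (R : NNReal), ∃ t ∈ Ioo (0 : ℝ) 1, ∀ (y : N) (l : ℝ), l ∈ Ioo (0 : ℝ) t →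
      (R : ℝ≥0∞) < G.edist hG x₀ (Ψ (y, l)))
    {t : ℝ} (ht : 0 < t) :
    ¬ IsCompact (closure (Ψ '' (univ ×ˢ Ioo (0 : ℝ) t))) := by
  intro hK
  obtain ⟨y₀⟩ := ‹Nonempty N›
  -- the deep points `Ψ(y₀, l)`, `l → 0⁺`, stay in the far part
  have hle : Filter.Tendsto (fun l : ℝ ↦ Ψ (y₀, l)) (𝓝[>] (0 : ℝ))
      (Filter.principal (closure (Ψ '' (univ ×ˢ Ioo (0 : ℝ) t)))) := by
    rw [Filter.tendsto_principal]
    filter_upwards [Ioo_mem_nhdsGT ht] with l hl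
    exact subset_closure ⟨(y₀, l), ⟨mem_univ _, hl⟩, rfl⟩
  -- so by compactness they have a cluster point `p`
  obtain ⟨p, -, hp⟩ := hK.exists_mapClusterPt hle
  -- deep points are at distance `> 1` from `p`
  obtain ⟨t', ht', hdeep⟩ := hfar p 1
  have hball : ∀ᶠ y in 𝓝 p, G.edist hG p y < 1 :=
    PseudoRiemannianMetric.setOf_edist_lt_mem_nhds hG p one_pos
  have hfreq : ∃ᶠ l in 𝓝[>] (0 : ℝ), G.edist hG p (Ψ (y₀, l)) < 1 := hp.frequently hball
  have hev : ∀ᶠ l in 𝓝[>] (0 : ℝ), (1 : ℝ≥0∞) < G.edist hG p (Ψ (y₀, l)) := by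
    filter_upwards [Ioo_mem_nhdsGT ht'.1] with l hl
    have hgt := hdeep y₀ l hl
    simpa only [ENNReal.coe_one] using hgt
  obtain ⟨l, hlt, hgt⟩ := (hfreq.and_eventually hev).exists
  exact lt_irrefl _ (hgt.trans hlt)

/-! ## The registered stub -/

/-- **S3 (`collarSheetData`).** For the crux's collar `Φ : Σ × (0,1) → W` (smooth, injective,
closure clause, `C⁰` cone asymptotics with `c > 0` over a Riemannian `g`) in ANY Riemannian
5-manifold `W`: there are a simply connected, locally path connected `T` and an open embedding
`ι : T → W` — namely `T = Σ × (0,t₀)`, `ι = Φ`, `t₀` the immersive depth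
(`C0AhRecognition.Sketch.stub_farCollarImmersive`; `Σ` is simply connected) — and an open
`U = Φ(Σ × (0,t))`, `t = t₀/2`, with `closure U = Φ(Σ × (0,t]) ⊆ range ι`, compact frontier
`⊆ Φ(Σ × {t})` (`CoreDistanceMorse.FarCollarPackage.closure_image_far'`) and NON-compact closure
(deep points `Φ(y,l)`, `l → 0`, are at unbounded distance:
`C0AhRecognition.Sketch.stub_farCollarIsFar`). [folklore] -/
theorem stub_collarSheetData (S : HomotopySphere 4)
    (g : PseudoRiemannianMetric (𝓡 4) ∞ (EuclideanSpace ℝ (Fin 4)) (TangentSpace (𝓡 4) : S.carrier → Type _))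
    (hg : g.IsRiemannian)
    (W : Type) [TopologicalSpace W] [T2Space W] [SecondCountableTopology W]
    [ChartedSpace (EuclideanSpace ℝ (Fin 5)) W] [IsManifold (𝓡 5) ∞ W]
    (G : PseudoRiemannianMetric (𝓡 5) ∞ (EuclideanSpace ℝ (Fin 5)) (TangentSpace (𝓡 5) : W → Type _))
    (hG : G.IsRiemannian) (c : ℝ) (Φ : S.carrier × ℝ → W) (hc : 0 < c)
    (hsm : ContMDiffOn ((𝓡 4).prod 𝓘(ℝ, ℝ)) (𝓡 5) ∞ Φ (univ ×ˢ Ioo (0 : ℝ) 1))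
    (hinj : InjOn Φ (univ ×ˢ Ioo (0 : ℝ) 1))
    (hcl : ∀ t ∈ Ioo (0 : ℝ) 1,
      closure (Φ '' (univ ×ˢ Ioo (0 : ℝ) t)) ⊆ Φ '' (univ ×ˢ Ioo (0 : ℝ) 1))
    (hasym : ∀ ε : ℝ, 0 < ε → ∃ t ∈ Ioo (0 : ℝ) 1, ∀ (x : S.carrier) (l : ℝ), l ∈ Ioo (0 : ℝ) t →
      ∀ (v : TangentSpace (𝓡 4) x) (s : ℝ),
        |G.val (Φ (x, l)) (mfderiv ((𝓡 4).prod 𝓘(ℝ, ℝ)) (𝓡 5) Φ (x, l) (v, s))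
            (mfderiv ((𝓡 4).prod 𝓘(ℝ, ℝ)) (𝓡 5) Φ (x, l) (v, s)) -
          c * (s ^ 2 + g.val x v v) / l ^ 2| ≤ ε * (c * (s ^ 2 + g.val x v v) / l ^ 2)) :
    ∃ (T : Type) (_ : TopologicalSpace T) (_ : SimplyConnectedSpace T) (_ : LocallyPathConnectedSpace T)
      (ι : T → W), Topology.IsEmbedding ι ∧ IsOpen (range ι) ∧
      ∃ U : Set W, IsOpen U ∧ closure U ⊆ range ι ∧ IsCompact (frontier U) ∧
        ¬ IsCompact (closure U) := by
  -- instances: `Σ ≠ ∅`, `π₁ Σ = 1`; `W` is locally compact Hausdorff (hence regular) and locally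
  -- path connected
  haveI : Nonempty S.carrier := Sketch.nonempty_carrier S
  haveI : SimplyConnectedSpace S.carrier := Sketch.simplyConnectedSpace_carrier S
  haveI : LocallyCompactSpace W := ChartedSpace.locallyCompactSpace (EuclideanSpace ℝ (Fin 5)) W
  haveI : LocallyPathConnectedSpace W :=
    ChartedSpace.locallyPathConnectedSpace (EuclideanSpace ℝ (Fin 5)) W
  -- the immersive depth `t₀` and the far-distance property of deep points
  obtain ⟨t₀, ht₀, himm⟩ :=
    C0AhRecognition.Sketch.stub_farCollarImmersive S.carrier g hg W G c Φ hc hasym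
  have hfar := C0AhRecognition.Sketch.stub_farCollarIsFar S.carrier g hg W G hG c Φ hc hsm hinj
    ⟨t₀, ht₀, himm⟩ hasym
  -- the sheet `T = Σ × (0,t₀)`, `ι = Φ|`
  have hι : Topology.IsOpenEmbedding
      (Φ ∘ (Prod.map id Subtype.val : S.carrier × Ioo (0 : ℝ) t₀ → S.carrier × ℝ)) :=
    isOpenEmbedding_strip Φ hsm hinj ht₀.2.le himm
  haveI : SimplyConnectedSpace (S.carrier × Ioo (0 : ℝ) t₀) :=
    simplyConnectedSpace_strip S.carrier ht₀.1
  haveI : LocallyPathConnectedSpace (S.carrier × Ioo (0 : ℝ) t₀) := hι.locallyPathConnectedSpace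
  refine ⟨S.carrier × Ioo (0 : ℝ) t₀, inferInstance, inferInstance, inferInstance,
    Φ ∘ (Prod.map id Subtype.val : S.carrier × Ioo (0 : ℝ) t₀ → S.carrier × ℝ),
    hι.isEmbedding, hι.isOpen_range, ?_⟩
  -- the far part `U = Φ(Σ × (0,t))`, `t = t₀ / 2`
  set t : ℝ := t₀ / 2 with ht_def
  have ht0 : 0 < t := by rw [ht_def]; exact half_pos ht₀.1
  have htt₀ : t < t₀ := by rw [ht_def]; exact half_lt_self ht₀.1
  have ht1 : t ∈ Ioo (0 : ℝ) 1 := ⟨ht0, htt₀.trans ht₀.2⟩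
  have hUo : IsOpen (Φ '' (univ ×ˢ Ioo (0 : ℝ) t)) :=
    FarCollarPackage.isOpen_image_far' Φ hsm ht₀.2.le himm htt₀.le
  have hUcl : closure (Φ '' (univ ×ˢ Ioo (0 : ℝ) t)) = Φ '' (univ ×ˢ Ioc (0 : ℝ) t) :=
    FarCollarPackage.closure_image_far' Φ G hG hsm.continuousOn hinj hcl hfar ht1
  refine ⟨Φ '' (univ ×ˢ Ioo (0 : ℝ) t), hUo, ?_, ?_, ?_⟩
  · -- `closure U = Φ(Σ × (0,t]) ⊆ Φ(Σ × (0,t₀)) = range ι`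
    rw [hUcl, range_strip]
    exact image_mono (prod_mono Subset.rfl (Ioc_subset_Ioo_right htt₀))
  · -- `frontier U ⊆ Φ(Σ × {t})`, a continuous image of a compact set
    have hK : IsCompact (Φ '' (univ ×ˢ {t})) := by
      refine (isCompact_univ.prod isCompact_singleton).image_of_continuousOn (hsm.continuousOn.mono ?_)
      exact prod_mono Subset.rfl (singleton_subset_iff.2 ht1)
    refine hK.of_isClosed_subset isClosed_frontier ?_
    rw [frontier, hUo.interior_eq, hUcl]
    rintro _ ⟨⟨x, hx, rfl⟩, hnot⟩
    refine ⟨x, ⟨mem_univ _, ?_⟩, rfl⟩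
    rcases hx.2.2.lt_or_eq with hlt | heq
    · exact absurd ⟨x, ⟨mem_univ _, hx.2.1, hlt⟩, rfl⟩ hnot
    · exact heq
  · -- `closure U` is not compact: deep points have no cluster point
    exact not_isCompact_closure_far Φ G hG hfar ht0

end Summit.SmoothPoincare4.SmoothPoincare4.Cruxes.AhHadamardFilling.UniversalCoverStripsTopology

end
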